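import Mathlib
import HarnessLib

/-!
# Cell pnp-psdrank, route `ChebyshevTracialDesign`: the weights of brick 139's `ε_A` under the scale substitutions of the γ-direction
# numerics (crux `TracialDecayExp20`, stmt-PneNP-19878)

Brick 140d, part 1 (eng g26; MEMO-30 §4 «126b-type numerics»). Prover g28's brick 139 (`…GammaDirectionSecondMomentRelative`) delivers brick 130's
`(hA)` with `ε_A = (E·R/4 + 1/(r+1)) + (λ₁+λ₂)/V + ((μ₁ + D(4/3)^D·μ₂)τ + φ·Far)/(LB·V)` explicit in `E, Γ, q, a, r, n, D`. In the scale
`P = N₀^{1/8}` of bricks 124a/140a–c (`E ≤ c_E/P⁵`, `Γ ≤ c_Γ·P`, `q ≤ c_q/P⁶`, `a ≤ P⁸`, `P⁸/16 ≤ r+1`, `P⁸/4 ≤ 2r+6`, `P⁸/8 ≤ 2r+4`, `r+3 ≤ P⁸`,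
`n ≤ 2P⁸ ≤ n`, `P⁸/2 ≤ n−2r−8`, `D ≤ 2P²`) each weight is bounded by ONE `gcongr` onto an explicit majorant followed by a closed form
(`field_simp; ring`): `lambda1_le` + `lambda2_le` ⇒ **`lambda_le`** (`λ₁+λ₂ ≤ K_λ·P⁷`, `K_λ = 640c_E + 8768c_Γc_q + 3456 + 10c_Γc_q² + 8192c_Γ`),
**`alpha_le`** (`E·R/4 + 1/(r+1) ≤ 8c_E/P⁵ + 16/P⁸`), `mu1_le` (`≤ 3072P⁸`), `mu2_le` (`≤ 98P¹⁶`), `phi_le` (`≤ 10P¹⁶`), and **`far_le`**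
(`(μ₁ + D(4/3)^Dμ₂)τ + φ·Far ≤ 1605·LB/P¹⁶` under `τ, D(4/3)^Dτ ≤ LB/(2P³²)`, `Far ≤ 4τ`). The threshold `ε_A ≤ ½` is part 2 (`…GammaDirectionNumericsA`).
Pure real arithmetic. WHAT THIS FILE DOES NOT DO: anything combinatorial; `TracialDecayExp20`, psd rank of P_PM(K_n), P vs NP.
[cite: RollinRoss2010, §4.1 Thm 4.2 (the variance scale)] [cite: Agarwal2000DifferenceEquations, Remark 1.8.1]
Stature: support/instrument (kernel lane, no defs, axioms standard). Supports stmt-PneNP-19878.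
-/

set_option linter.dupNamespace false -- `Summit.PneNP.PneNP.…`: summit = sub-problem (D-0017)

noncomputable section

namespace Summit.PneNP.PneNP.Theorems.ChebyshevTracialDesignGammaDirectionNumericsAWeights

/-! ### §1 The weights of `ε_A` under the scale substitutions -/

/-- The `k = 1` part `λ₁` of the `V`-numerator of brick 139's `ε_A` under the scale substitutions.
[cite: RollinRoss2010, §4.1 Thm 4.2 (the variance scale)] -/
theorem lambda1_le {E n r a Γ q cE cΓ cq P : ℝ} (hP : 1 ≤ P) (hE : E ≤ cE / P ^ 5)
    (ha0 : 0 ≤ a) (ha : a ≤ P ^ 8) (h2a1 : 2 * a + 1 ≤ 3 * P ^ 8)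
    (hr0 : 0 ≤ r) (hr1 : P ^ 8 / 16 ≤ r + 1) (hr2 : P ^ 8 / 16 ≤ r + 2) (hr6 : P ^ 8 / 4 ≤ 2 * r + 6)
    (hr3 : r + 3 ≤ P ^ 8) (h2ar : 2 * a + r + 3 ≤ 3 * P ^ 8)
    (hn0 : 0 ≤ n) (hn : n ≤ 2 * P ^ 8) (hn2 : n - 2 ≤ 2 * P ^ 8) (hn2' : 0 ≤ n - 2) (hnr : P ^ 8 / 2 ≤ n - 2 * r - 8)
    (hΓ0 : 0 ≤ Γ) (hΓ : Γ ≤ cΓ * P) (hq0 : 0 ≤ q) (hq : q ≤ cq / P ^ 6) (hcE : 0 ≤ cE) (hcΓ : 0 ≤ cΓ) (hcq : 0 ≤ cq) :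
    E * (n * (n - 2) / ((2 * r + 6) * (n - 2 * r - 8))) / 4 * (2 * a ^ 2 / (r + 1) + (2 * a + 1) * a / (r + 2)) +
            (2 * a + 1) * (r + 3) / (2 * (r + 2) * (r + 1)) *
              (a * (4 * Γ * q + (2 + 4 * Γ * q) / (2 * r + 6))) +
            a * (2 * a + r + 3) / (2 * (r + 2) * (r + 1)) * (1 + 2 * Γ * q) ≤
      (640 * cE + 8448 * cΓ * cq + 3456) * P ^ 7 := by
  have hP0 : 0 < P := by linarith
  have hR0 : 0 ≤ n * (n - 2) / ((2 * r + 6) * (n - 2 * r - 8)) :=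
    div_nonneg (mul_nonneg hn0 hn2') (mul_nonneg (by linarith) (by linarith))
  have hM : E * (n * (n - 2) / ((2 * r + 6) * (n - 2 * r - 8))) / 4 * (2 * a ^ 2 / (r + 1) + (2 * a + 1) * a / (r + 2)) +
            (2 * a + 1) * (r + 3) / (2 * (r + 2) * (r + 1)) *
              (a * (4 * Γ * q + (2 + 4 * Γ * q) / (2 * r + 6))) +
            a * (2 * a + r + 3) / (2 * (r + 2) * (r + 1)) * (1 + 2 * Γ * q) ≤
      (cE / P ^ 5) * ((2 * P ^ 8) * (2 * P ^ 8) / ((P ^ 8 / 4) * (P ^ 8 / 2))) / 4 *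
          (2 * (P ^ 8) ^ 2 / (P ^ 8 / 16) + (3 * P ^ 8) * P ^ 8 / (P ^ 8 / 16)) +
            (3 * P ^ 8) * (P ^ 8) / (2 * (P ^ 8 / 16) * (P ^ 8 / 16)) *
              (P ^ 8 * (4 * (cΓ * P) * (cq / P ^ 6) + (2 + 4 * (cΓ * P) * (cq / P ^ 6)) / (P ^ 8 / 4))) +
            P ^ 8 * (3 * P ^ 8) / (2 * (P ^ 8 / 16) * (P ^ 8 / 16)) * (1 + 2 * (cΓ * P) * (cq / P ^ 6)) := by gcongr
  refine hM.trans ?_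
  have e : (cE / P ^ 5) * ((2 * P ^ 8) * (2 * P ^ 8) / ((P ^ 8 / 4) * (P ^ 8 / 2))) / 4 *
          (2 * (P ^ 8) ^ 2 / (P ^ 8 / 16) + (3 * P ^ 8) * P ^ 8 / (P ^ 8 / 16)) +
            (3 * P ^ 8) * (P ^ 8) / (2 * (P ^ 8 / 16) * (P ^ 8 / 16)) *
              (P ^ 8 * (4 * (cΓ * P) * (cq / P ^ 6) + (2 + 4 * (cΓ * P) * (cq / P ^ 6)) / (P ^ 8 / 4))) +
            P ^ 8 * (3 * P ^ 8) / (2 * (P ^ 8 / 16) * (P ^ 8 / 16)) * (1 + 2 * (cΓ * P) * (cq / P ^ 6)) =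
      640 * cE * P ^ 3 + 1536 * cΓ * cq * P ^ 3 + 3072 + 6144 * cΓ * cq / P ^ 5 + 384 + 768 * cΓ * cq / P ^ 5 := by
    field_simp
    ring
  rw [e]
  have hP7 : (1 : ℝ) ≤ P ^ 7 := one_le_pow₀ hP
  have hP37 : P ^ 3 ≤ P ^ 7 := pow_le_pow_right₀ hP (by norm_num)
  have hinv : 1 / P ^ 5 ≤ 1 := by rw [div_le_one (by positivity)]; exact one_le_pow₀ hP
  have hinv7 : 1 / P ^ 5 ≤ P ^ 7 := hinv.trans hP7
  have h1 : 640 * cE * P ^ 3 ≤ 640 * cE * P ^ 7 := mul_le_mul_of_nonneg_left hP37 (by positivity)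
  have h2 : 1536 * cΓ * cq * P ^ 3 ≤ 1536 * cΓ * cq * P ^ 7 := mul_le_mul_of_nonneg_left hP37 (by positivity)
  have h3 : 6144 * cΓ * cq / P ^ 5 ≤ 6144 * cΓ * cq * P ^ 7 := by
    rw [div_eq_mul_one_div]; exact mul_le_mul_of_nonneg_left hinv7 (by positivity)
  have h4 : 768 * cΓ * cq / P ^ 5 ≤ 768 * cΓ * cq * P ^ 7 := by
    rw [div_eq_mul_one_div]; exact mul_le_mul_of_nonneg_left hinv7 (by positivity)
  nlinarith only [h1, h2, h3, h4, hcE, hcΓ, hcq, hP7]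

/-- The `k ≥ 2` part `λ₂`. [cite: RollinRoss2010, §4.1 Thm 4.2 (the variance scale)] -/
theorem lambda2_le {r a Γ q cΓ cq P : ℝ} {D : ℕ} (hP : 1 ≤ P) (ha0 : 0 ≤ a) (ha : a ≤ P ^ 8) (h2a1 : 2 * a + 1 ≤ 3 * P ^ 8)
    (hr0 : 0 ≤ r) (hr6 : P ^ 8 / 4 ≤ 2 * r + 6) (hr4 : P ^ 8 / 8 ≤ 2 * r + 4)
    (hΓ0 : 0 ≤ Γ) (hΓ : Γ ≤ cΓ * P) (hq0 : 0 ≤ q) (hq : q ≤ cq / P ^ 6) (hD : (D : ℝ) ≤ 2 * P ^ 2) (hcΓ : 0 ≤ cΓ) (hcq : 0 ≤ cq) :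
    (D : ℝ) * (2 * Γ * q ^ 2 * a ^ 2 + 8 * (D : ℝ) * Γ * q * a ^ 2 / (2 * r + 6) +
            32 * (D : ℝ) ^ 2 * Γ * a ^ 2 / ((2 * r + 6) * (2 * r + 4)) +
            (2 * a + 1) * a * (Γ * q ^ 2 + 4 * (D : ℝ) * Γ * q / (2 * r + 6))) ≤
      (10 * cΓ * cq ^ 2 + 320 * cΓ * cq + 8192 * cΓ) * P ^ 7 := by
  have hP0 : 0 < P := by linarith
  have hM : (D : ℝ) * (2 * Γ * q ^ 2 * a ^ 2 + 8 * (D : ℝ) * Γ * q * a ^ 2 / (2 * r + 6) +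
            32 * (D : ℝ) ^ 2 * Γ * a ^ 2 / ((2 * r + 6) * (2 * r + 4)) +
            (2 * a + 1) * a * (Γ * q ^ 2 + 4 * (D : ℝ) * Γ * q / (2 * r + 6))) ≤
      (2 * P ^ 2 : ℝ) * (2 * (cΓ * P) * (cq / P ^ 6) ^ 2 * (P ^ 8) ^ 2 +
              8 * (2 * P ^ 2 : ℝ) * (cΓ * P) * (cq / P ^ 6) * (P ^ 8) ^ 2 / (P ^ 8 / 4) +
            32 * (2 * P ^ 2 : ℝ) ^ 2 * (cΓ * P) * (P ^ 8) ^ 2 / ((P ^ 8 / 4) * (P ^ 8 / 8)) +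
            (3 * P ^ 8) * P ^ 8 * ((cΓ * P) * (cq / P ^ 6) ^ 2 + 4 * (2 * P ^ 2 : ℝ) * (cΓ * P) * (cq / P ^ 6) / (P ^ 8 / 4))) := by gcongr
  refine hM.trans (le_of_eq ?_)
  field_simp
  ring

/-- **The `V`-numerator `λ₁ + λ₂ ≤ K_λ·P⁷`**, `K_λ = 640c_E + 8768c_Γc_q + 3456 + 10c_Γc_q² + 8192c_Γ`.
[cite: RollinRoss2010, §4.1 Thm 4.2 (the variance scale)] -/
theorem lambda_le {E n r a Γ q cE cΓ cq P : ℝ} {D : ℕ} (hP : 1 ≤ P) (hE : E ≤ cE / P ^ 5)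
    (ha0 : 0 ≤ a) (ha : a ≤ P ^ 8) (h2a1 : 2 * a + 1 ≤ 3 * P ^ 8)
    (hr0 : 0 ≤ r) (hr1 : P ^ 8 / 16 ≤ r + 1) (hr2 : P ^ 8 / 16 ≤ r + 2) (hr6 : P ^ 8 / 4 ≤ 2 * r + 6)
    (hr4 : P ^ 8 / 8 ≤ 2 * r + 4) (hr3 : r + 3 ≤ P ^ 8) (h2ar : 2 * a + r + 3 ≤ 3 * P ^ 8)
    (hn0 : 0 ≤ n) (hn : n ≤ 2 * P ^ 8) (hn2 : n - 2 ≤ 2 * P ^ 8) (hn2' : 0 ≤ n - 2) (hnr : P ^ 8 / 2 ≤ n - 2 * r - 8)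
    (hΓ0 : 0 ≤ Γ) (hΓ : Γ ≤ cΓ * P) (hq0 : 0 ≤ q) (hq : q ≤ cq / P ^ 6) (hD : (D : ℝ) ≤ 2 * P ^ 2)
    (hcE : 0 ≤ cE) (hcΓ : 0 ≤ cΓ) (hcq : 0 ≤ cq) :
    E * (n * (n - 2) / ((2 * r + 6) * (n - 2 * r - 8))) / 4 * (2 * a ^ 2 / (r + 1) + (2 * a + 1) * a / (r + 2)) +
            (2 * a + 1) * (r + 3) / (2 * (r + 2) * (r + 1)) *
              (a * (4 * Γ * q + (2 + 4 * Γ * q) / (2 * r + 6))) +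
            a * (2 * a + r + 3) / (2 * (r + 2) * (r + 1)) * (1 + 2 * Γ * q) +
            (D : ℝ) * (2 * Γ * q ^ 2 * a ^ 2 + 8 * (D : ℝ) * Γ * q * a ^ 2 / (2 * r + 6) +
            32 * (D : ℝ) ^ 2 * Γ * a ^ 2 / ((2 * r + 6) * (2 * r + 4)) +
            (2 * a + 1) * a * (Γ * q ^ 2 + 4 * (D : ℝ) * Γ * q / (2 * r + 6))) ≤
      (640 * cE + 8768 * cΓ * cq + 3456 + 10 * cΓ * cq ^ 2 + 8192 * cΓ) * P ^ 7 := by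
  have h1 := lambda1_le hP hE ha0 ha h2a1 hr0 hr1 hr2 hr6 hr3 h2ar hn0 hn hn2 hn2' hnr hΓ0 hΓ hq0 hq hcE hcΓ hcq
  have h2 := lambda2_le (D := D) hP ha0 ha h2a1 hr0 hr6 hr4 hΓ0 hΓ hq0 hq hD hcΓ hcq
  have hP7 : (0 : ℝ) ≤ P ^ 7 := by positivity
  nlinarith only [h1, h2, hP7, hcΓ, hcq]

/-- The `α`-part: `E·R/4 + 1/(r+1) ≤ 8c_E/P⁵ + 16/P⁸`. [cite: RollinRoss2010, §4.1 Thm 4.2 (the variance scale)] -/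
theorem alpha_le {E n r cE P : ℝ} (hP : 1 ≤ P) (hE : E ≤ cE / P ^ 5) (hcE : 0 ≤ cE)
    (hr0 : 0 ≤ r) (hr1 : P ^ 8 / 16 ≤ r + 1) (hr6 : P ^ 8 / 4 ≤ 2 * r + 6)
    (hn0 : 0 ≤ n) (hn : n ≤ 2 * P ^ 8) (hn2 : n - 2 ≤ 2 * P ^ 8) (hn2' : 0 ≤ n - 2) (hnr : P ^ 8 / 2 ≤ n - 2 * r - 8) :
    E * (n * (n - 2) / ((2 * r + 6) * (n - 2 * r - 8))) / 4 + 1 / (r + 1) ≤ 8 * cE / P ^ 5 + 16 / P ^ 8 := by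
  have hP0 : 0 < P := by linarith
  have hR0 : 0 ≤ n * (n - 2) / ((2 * r + 6) * (n - 2 * r - 8)) :=
    div_nonneg (mul_nonneg hn0 hn2') (mul_nonneg (by linarith) (by linarith))
  have hM : E * (n * (n - 2) / ((2 * r + 6) * (n - 2 * r - 8))) / 4 + 1 / (r + 1) ≤
      (cE / P ^ 5) * ((2 * P ^ 8) * (2 * P ^ 8) / ((P ^ 8 / 4) * (P ^ 8 / 2))) / 4 + 1 / (P ^ 8 / 16) := by gcongr
  refine hM.trans (le_of_eq ?_)
  field_simp
  ring

/-- The `τ`-weight of the `k = 1` far terms: `μ₁ ≤ 3072·P⁸`. [cite: RollinRoss2010, §4.1 Thm 4.2 (the variance scale)] -/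
theorem mu1_le {a r P : ℝ} (hP : 1 ≤ P) (ha0 : 0 ≤ a) (ha : a ≤ P ^ 8) (h2a1 : 2 * a + 1 ≤ 3 * P ^ 8)
    (hr0 : 0 ≤ r) (hr1 : P ^ 8 / 16 ≤ r + 1) (hr2 : P ^ 8 / 16 ≤ r + 2) (hr3 : r + 3 ≤ P ^ 8) (h2ar : 2 * a + r + 3 ≤ 3 * P ^ 8) :
    (2 * a + 1) * (r + 3) / (2 * (r + 2) * (r + 1)) * (16 * a / 3) + a * (2 * a + r + 3) / (2 * (r + 2) * (r + 1)) * (8 / 3) ≤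
      3072 * P ^ 8 := by
  have hP0 : 0 < P := by linarith
  have hM : (2 * a + 1) * (r + 3) / (2 * (r + 2) * (r + 1)) * (16 * a / 3) + a * (2 * a + r + 3) / (2 * (r + 2) * (r + 1)) * (8 / 3) ≤
      (3 * P ^ 8) * P ^ 8 / (2 * (P ^ 8 / 16) * (P ^ 8 / 16)) * (16 * P ^ 8 / 3) +
        P ^ 8 * (3 * P ^ 8) / (2 * (P ^ 8 / 16) * (P ^ 8 / 16)) * (8 / 3) := by gcongr
  refine hM.trans ?_
  have e : (3 * P ^ 8) * P ^ 8 / (2 * (P ^ 8 / 16) * (P ^ 8 / 16)) * (16 * P ^ 8 / 3) +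
        P ^ 8 * (3 * P ^ 8) / (2 * (P ^ 8 / 16) * (P ^ 8 / 16)) * (8 / 3) = 2048 * P ^ 8 + 1024 := by
    field_simp
    ring
  rw [e]
  have : (1 : ℝ) ≤ P ^ 8 := one_le_pow₀ hP
  linarith

/-- The `τ`-weight of the `k ≥ 2` far terms (without the factor `D(4/3)^D`): `μ₂ ≤ 98·P¹⁶`. [cite: RollinRoss2010, §4.1 Thm 4.2 (the variance scale)] -/
theorem mu2_le {a r n P : ℝ} {D : ℕ} (hP : 1 ≤ P) (ha0 : 0 ≤ a) (ha : a ≤ P ^ 8) (h2a1 : 2 * a + 1 ≤ 3 * P ^ 8)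
    (hr0 : 0 ≤ r) (h2r6 : 2 * r + 6 ≤ 2 * P ^ 8) (h2r4 : 2 * r + 4 ≤ 2 * P ^ 8)
    (hnn : 2 * P ^ 8 ≤ n) (hnY : P ^ 8 ≤ n - 2) (hD : (D : ℝ) ≤ 2 * P ^ 2) (hrD : 2 * r + 6 + 4 * (D : ℝ) ≤ 2 * P ^ 8 + 4 * (2 * P ^ 2)) :
    a ^ 2 * ((2 * r + 6) * (2 * r + 4) / (n * (n - 2)) + 8 * (D : ℝ) * (2 * r + 4) / (n * (n - 2)) +
        32 * (D : ℝ) ^ 2 / (n * (n - 2)) + 1) + (2 * a + 1) * a * ((2 * r + 6 + 4 * (D : ℝ)) / n) ≤ 98 * P ^ 16 := by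
  have hP0 : 0 < P := by linarith
  have hY : (1 : ℝ) ≤ P ^ 8 := one_le_pow₀ hP
  have hn0 : 0 ≤ n := by linarith
  have hn2 : 0 ≤ n - 2 := by linarith
  have hnn2 : 0 ≤ n * (n - 2) := mul_nonneg hn0 hn2
  have hbr : 0 ≤ (2 * r + 6) * (2 * r + 4) / (n * (n - 2)) + 8 * (D : ℝ) * (2 * r + 4) / (n * (n - 2)) +
      32 * (D : ℝ) ^ 2 / (n * (n - 2)) + 1 := by positivity
  have hM : a ^ 2 * ((2 * r + 6) * (2 * r + 4) / (n * (n - 2)) + 8 * (D : ℝ) * (2 * r + 4) / (n * (n - 2)) +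
        32 * (D : ℝ) ^ 2 / (n * (n - 2)) + 1) + (2 * a + 1) * a * ((2 * r + 6 + 4 * (D : ℝ)) / n) ≤
      (P ^ 8) ^ 2 * ((2 * P ^ 8) * (2 * P ^ 8) / ((2 * P ^ 8) * P ^ 8) + 8 * (2 * P ^ 2 : ℝ) * (2 * P ^ 8) / ((2 * P ^ 8) * P ^ 8) +
        32 * (2 * P ^ 2 : ℝ) ^ 2 / ((2 * P ^ 8) * P ^ 8) + 1) + (3 * P ^ 8) * P ^ 8 * ((2 * P ^ 8 + 4 * (2 * P ^ 2)) / (2 * P ^ 8)) := by gcongr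
  refine hM.trans ?_
  have e : (P ^ 8) ^ 2 * ((2 * P ^ 8) * (2 * P ^ 8) / ((2 * P ^ 8) * P ^ 8) + 8 * (2 * P ^ 2 : ℝ) * (2 * P ^ 8) / ((2 * P ^ 8) * P ^ 8) +
        32 * (2 * P ^ 2 : ℝ) ^ 2 / ((2 * P ^ 8) * P ^ 8) + 1) + (3 * P ^ 8) * P ^ 8 * ((2 * P ^ 8 + 4 * (2 * P ^ 2)) / (2 * P ^ 8)) =
      6 * P ^ 16 + 28 * P ^ 10 + 64 * P ^ 4 := by
    field_simp
    ring
  rw [e]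
  have h1 : P ^ 10 ≤ P ^ 16 := pow_le_pow_right₀ hP (by norm_num)
  have h2 : P ^ 4 ≤ P ^ 16 := pow_le_pow_right₀ hP (by norm_num)
  linarith

/-- The `Far`-weight: `φ ≤ 10·P¹⁶`. [cite: RollinRoss2010, §4.1 Thm 4.2 (the variance scale)] -/
theorem phi_le {a r P : ℝ} (hP : 1 ≤ P) (ha0 : 0 ≤ a) (h2a1 : 2 * a + 1 ≤ 3 * P ^ 8)
    (hr0 : 0 ≤ r) (hr1 : P ^ 8 / 16 ≤ r + 1) (hr2Y : r + 2 ≤ P ^ 8) (hra : r + 2 + a ≤ 2 * P ^ 8) :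
    ((r + 2 + a) ^ 2 + 2 * (r + 2) ^ 2 / (r + 1) + (2 * a + 1)) / 4 ≤ 10 * P ^ 16 := by
  have hP0 : 0 < P := by linarith
  have hY : (1 : ℝ) ≤ P ^ 8 := one_le_pow₀ hP
  have hM : ((r + 2 + a) ^ 2 + 2 * (r + 2) ^ 2 / (r + 1) + (2 * a + 1)) / 4 ≤
      ((2 * P ^ 8) ^ 2 + 2 * (P ^ 8) ^ 2 / (P ^ 8 / 16) + (3 * P ^ 8)) / 4 := by gcongr
  refine hM.trans ?_
  have e : ((2 * P ^ 8) ^ 2 + 2 * (P ^ 8) ^ 2 / (P ^ 8 / 16) + (3 * P ^ 8)) / 4 = P ^ 16 + 35 / 4 * P ^ 8 := by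
    field_simp
    ring
  rw [e]
  have h1 : P ^ 8 ≤ P ^ 16 := pow_le_pow_right₀ hP (by norm_num)
  linarith

/-- **The far numerator**: `(μ₁ + D(4/3)^D·μ₂)·τ + φ·Far ≤ 1605·LB/P¹⁶` under the far-term budgets `τ, D(4/3)^Dτ ≤ LB/(2P³²)`, `Far ≤ 4τ`.
[cite: RollinRoss2010, §4.1 Thm 4.2 (the variance scale)] [cite: Agarwal2000DifferenceEquations, Remark 1.8.1] -/
theorem far_le {a r n P LB τ Far : ℝ} {D : ℕ} (hP1 : 1 ≤ P) (ha0 : 0 ≤ a) (ha : a ≤ P ^ 8) (h2a1 : 2 * a + 1 ≤ 3 * P ^ 8)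
    (hr0 : 0 ≤ r) (hr1 : P ^ 8 / 16 ≤ r + 1) (hr2 : P ^ 8 / 16 ≤ r + 2) (hr3 : r + 3 ≤ P ^ 8) (h2ar : 2 * a + r + 3 ≤ 3 * P ^ 8)
    (hr2Y : r + 2 ≤ P ^ 8) (hra : r + 2 + a ≤ 2 * P ^ 8) (h2r6 : 2 * r + 6 ≤ 2 * P ^ 8) (h2r4 : 2 * r + 4 ≤ 2 * P ^ 8)
    (hnn : 2 * P ^ 8 ≤ n) (hnY : P ^ 8 ≤ n - 2) (hD : (D : ℝ) ≤ 2 * P ^ 2) (hrD : 2 * r + 6 + 4 * (D : ℝ) ≤ 2 * P ^ 8 + 4 * (2 * P ^ 2))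
    (hLB : 0 < LB) (hτ0 : 0 ≤ τ) (hτ : τ ≤ LB / (2 * P ^ 32)) (hDτ : (D : ℝ) * (4 / 3 : ℝ) ^ D * τ ≤ LB / (2 * P ^ 32))
    (hFar0 : 0 ≤ Far) (hFar : Far ≤ 4 * τ) :
    (((2 * a + 1) * (r + 3) / (2 * (r + 2) * (r + 1)) * (16 * a / 3) + a * (2 * a + r + 3) / (2 * (r + 2) * (r + 1)) * (8 / 3) +
              (D : ℝ) * (4 / 3 : ℝ) ^ D *
            (a ^ 2 * ((2 * r + 6) * (2 * r + 4) / (n * (n - 2)) + 8 * (D : ℝ) * (2 * r + 4) / (n * (n - 2)) +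
                32 * (D : ℝ) ^ 2 / (n * (n - 2)) + 1) +
              (2 * a + 1) * a * ((2 * r + 6 + 4 * (D : ℝ)) / n))) * τ +
            (((r + 2 + a) ^ 2 + 2 * (r + 2) ^ 2 / (r + 1) + (2 * a + 1)) / 4) * Far) ≤ 1605 * LB / P ^ 16 := by
  have hP0 : 0 < P := by linarith
  have hM1 := mu1_le hP1 ha0 ha h2a1 hr0 hr1 hr2 hr3 h2ar
  have hM2 := mu2_le (D := D) hP1 ha0 ha h2a1 hr0 h2r6 h2r4 hnn hnY hD hrD
  have hΦ := phi_le hP1 ha0 h2a1 hr0 hr1 hr2Y hra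
  have hDτ0 : 0 ≤ (D : ℝ) * (4 / 3 : ℝ) ^ D * τ := by positivity
  have hP16 : (0 : ℝ) ≤ P ^ 16 := by positivity
  have h10P16 : (0 : ℝ) ≤ 10 * P ^ 16 := by positivity
  have hM2 := mu2_le (D := D) hP1 ha0 ha h2a1 hr0 h2r6 h2r4 hnn hnY hD hrD
  have id3 : P ^ 16 * (LB / (2 * P ^ 32)) = LB / (2 * P ^ 16) := by
    rw [eq_div_iff (by positivity)]; field_simp
  have id4 : (1605 : ℝ) * LB / P ^ 16 = 3210 * (LB / (2 * P ^ 16)) := by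
    rw [eq_comm, mul_div_assoc', div_eq_div_iff (by positivity) (by positivity)]; ring
  have h1 : ((2 * a + 1) * (r + 3) / (2 * (r + 2) * (r + 1)) * (16 * a / 3) + a * (2 * a + r + 3) / (2 * (r + 2) * (r + 1)) * (8 / 3)) * τ ≤ 3072 * P ^ 8 * τ := mul_le_mul_of_nonneg_right hM1 hτ0
  have h2 : (D : ℝ) * (4 / 3 : ℝ) ^ D * (a ^ 2 * ((2 * r + 6) * (2 * r + 4) / (n * (n - 2)) + 8 * (D : ℝ) * (2 * r + 4) / (n * (n - 2)) +
              32 * (D : ℝ) ^ 2 / (n * (n - 2)) + 1) +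
            (2 * a + 1) * a * ((2 * r + 6 + 4 * (D : ℝ)) / n)) * τ ≤ 98 * P ^ 16 * ((D : ℝ) * (4 / 3 : ℝ) ^ D * τ) := by
    have := mul_le_mul_of_nonneg_left hM2 hDτ0
    linarith only [this]
  have h3 : (((r + 2 + a) ^ 2 + 2 * (r + 2) ^ 2 / (r + 1) + (2 * a + 1)) / 4) * Far ≤ 10 * P ^ 16 * (4 * τ) := mul_le_mul hΦ hFar hFar0 h10P16
  have h4 : 3072 * P ^ 8 * τ ≤ 3072 * P ^ 16 * τ := by
    have : P ^ 8 ≤ P ^ 16 := pow_le_pow_right₀ hP1 (by norm_num)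
    exact mul_le_mul_of_nonneg_right (mul_le_mul_of_nonneg_left this (by norm_num)) hτ0
  have h5 : P ^ 16 * τ ≤ P ^ 16 * (LB / (2 * P ^ 32)) := mul_le_mul_of_nonneg_left hτ hP16
  have h6 : P ^ 16 * ((D : ℝ) * (4 / 3 : ℝ) ^ D * τ) ≤ P ^ 16 * (LB / (2 * P ^ 32)) := mul_le_mul_of_nonneg_left hDτ hP16
  have e : P ^ 16 * (LB / (2 * P ^ 32)) = LB / (2 * P ^ 16) := id3
  have esplit : (((2 * a + 1) * (r + 3) / (2 * (r + 2) * (r + 1)) * (16 * a / 3) + a * (2 * a + r + 3) / (2 * (r + 2) * (r + 1)) * (8 / 3) +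
            (D : ℝ) * (4 / 3 : ℝ) ^ D *
          (a ^ 2 * ((2 * r + 6) * (2 * r + 4) / (n * (n - 2)) + 8 * (D : ℝ) * (2 * r + 4) / (n * (n - 2)) +
              32 * (D : ℝ) ^ 2 / (n * (n - 2)) + 1) +
            (2 * a + 1) * a * ((2 * r + 6 + 4 * (D : ℝ)) / n))) * τ +
          (((r + 2 + a) ^ 2 + 2 * (r + 2) ^ 2 / (r + 1) + (2 * a + 1)) / 4) * Far) = ((2 * a + 1) * (r + 3) / (2 * (r + 2) * (r + 1)) * (16 * a / 3) + a * (2 * a + r + 3) / (2 * (r + 2) * (r + 1)) * (8 / 3)) * τ + (D : ℝ) * (4 / 3 : ℝ) ^ D * (a ^ 2 * ((2 * r + 6) * (2 * r + 4) / (n * (n - 2)) + 8 * (D : ℝ) * (2 * r + 4) / (n * (n - 2)) +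
              32 * (D : ℝ) ^ 2 / (n * (n - 2)) + 1) +
            (2 * a + 1) * a * ((2 * r + 6 + 4 * (D : ℝ)) / n)) * τ + (((r + 2 + a) ^ 2 + 2 * (r + 2) ^ 2 / (r + 1) + (2 * a + 1)) / 4) * Far := by ring
  rw [esplit]
  have e2 : (1605 : ℝ) * LB / P ^ 16 = 3210 * (LB / (2 * P ^ 16)) := id4
  rw [e2]
  nlinarith only [h1, h2, h3, h4, h5, h6, e, hτ0]

end Summit.PneNP.PneNP.Theorems.ChebyshevTracialDesignGammaDirectionNumericsAWeights

end
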